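import Literature.Probability.LatticeModels.InterfaceSLETightness
import Literature.Probability.LatticeModels.FKIsingInterfaceIdentification
import Literature.Probability.RandomPlanarGeometry.SLELawOfDrivingProcess
import Literature.Probability.RandomPlanarGeometry.LoewnerDescription
import Literature.Probability.RandomPlanarGeometry.SLEUniquenessInLaw
import HarnessLib

/-!
# Critical Ising interfaces and SLE₃: uniqueness discharged, and the CDHKS martingales in Lévy's format

Topic `Literature/Probability/LatticeModels` (family `crit-ising`). Fourth file of the
decomposition of **crit-ising.S17, spin half** (Chelkak–Duminil-Copin–Hongler–Kemppainen–
Smirnov, C. R. Math. Acad. Sci. Paris 352 (2014) 157–161, Theorem 1: critical spin-Ising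
Dobrushin interfaces converge to chordal SLE₃), after `InterfaceSLE.lean` (the statement
`convergesInLawToSLE_three_isingInterface`), `InterfaceSLEProofs.lean` (its corrected
transcription `convergesInLawToSLE_three_isingInterface_zd`, reduced there to **F1** (tightness,
CDHKS §2), **F2** `isSLELaw_three_of_subseqLimit_spinInterface` (identification, CDHKS §3) and
uniqueness in law of chordal SLE) and `InterfaceSLETightness.lean` (F1 ⇐ the arm-type estimate
**(C1)** `spinInterface_traversalBound`).

Two things happen here (theorems only; no definition, no named fact).

* **Uniqueness in law of chordal SLE is now a theorem** (`IsSLECurve.map_eq_holds`,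
  `RandomPlanarGeometry/SLEUniquenessInLaw.lean`), so the hypothesis `huniq` disappears from the
  assemblies: `convergesInLawToSLE_three_isingInterface_zd_of_facts'` (F1 ∧ F2 ⟹ S17-zd) and
  `convergesInLawToSLE_three_isingInterface_zd_of_traversalBound'` ((C1) ∧ F2 ⟹ S17-zd); likewise
  for the FK half (CDHKS Thm. 2): `convergesInLawToSLE_sixteen_thirds_fkInterface_of_traversalBound'`
  ((C1-FK) ∧ (L) ⟹ CDHKS Thm. 2). (Its companion `…_of_layer2'`, the same assembly through the
  layer-2 named fact (L′) `exists_isSLEDrivingCoupling_of_isSubseqLimitLaw_fkInterfaceCurve` of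
  `FKIsingInterfaceIdentification.lean`, was deleted when the D-0026 review of that fact merged
  (L′) back into (L) `isSLELaw_of_isSubseqLimitLaw_fkInterfaceCurve`, to which the tree proves it
  equivalent; see the review note in `FKIsingInterfaceIdentification.lean`.)
* **The two CDHKS martingales in Lévy's format.** CDHKS's proof of Thm. 1 ends (§3, p. 7 of
  the arXiv version): "both coefficients `W_t` and `W_t² - 3t` are martingales. As `W_t` is
  almost surely continuous, Lévy's theorem implies that `W_t = √3 B_t` … for any subsequential
  limit of the curves `γ^δ`." `isLocalMartingale_and_hasQuadraticVariation_of_martingales`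
  PROVES the reformulation this sentence uses: if `W_t` and `W_t² - 3t` are martingales for a
  filtration `𝓕` on the curve space, then `X = W/√3` is a continuous-time local martingale with
  quadratic variation `⟨X⟩_t = t` (`Process.HasQuadraticVariation`), i.e. exactly the input of
  Lévy's characterisation; `measurable_of_martingale` records the Borel measurability of the
  marginals. The conclusion "hence `ν` is the SLE₃ law" is drawn downstream
  (`InterfaceSLEFrontier.lean`), where Lévy's characterisation and the Rohde–Schramm trace
  theorems at `κ = 3` are available as theorems.

**Review note (D-0026, 2026-08-15): the named fact (M) is merged back into F2.** Earlier
versions of this file vendored CDHKS's printed §3 conclusion about the driving process as a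
named fact **(M)** `exists_drivingMartingales_of_subseqLimit_spinInterface` — for every
subsequential weak limit `ν` of the critical spin-Ising interface laws there are a chordal
uniformizing map `φ`, a process `W` on the curve space and a filtration `𝓕` with `ν`-a.e.
`IsLoewnerDescribed φ c (W c) ∧ W c 0 = 0` (CDHKS Thm. 3 = Kemppainen–Smirnov 2017, Thm. 1.5)
and `W_t`, `W_t² - 3t` martingales (CDHKS §3) — and reduced F2 to (M), Lévy's characterisation
and the Rohde–Schramm trace theorems (`isSLELaw_three_of_subseqLimit_spinInterface_of_drivingMartingales`,
`convergesInLawToSLE_three_isingInterface_zd_of_layer2`). The D-0026 review of that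
decomposition (the prove-seat of (M) having triaged it XL) found, with CDHKS pp. 5 and 7 and
Kemppainen–Smirnov Thm. 1.3/Cor. 1.5 (arXiv numbering) open: (M) is faithful to the source but
is not a distinct, separately citable result of its own size — it is F2 minus the last sentence
of F2's printed proof (Lévy's theorem, meanwhile a theorem of the tree), it carries exactly F2's
unvendored inputs (Kemppainen–Smirnov 2017, Thm. 1.5 with Cor. 1.7, ≈ 80 pp.; Chelkak–Smirnov
2012, Thms 1.2 and 5.6, ≈ 65 pp.), and, being stated with true martingales, it even needs the
exponential-moment clause of CDHKS Thm. 3 which F2 does not (`InterfaceSLELocal.lean`,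
`InterfaceSLELimitData.lean` derive F2 moment-free from describability, driver convergence and
the discrete observable martingales, by localisation). (M) was therefore MERGED back into F2's
proof obligation: the def and its two consumers are deleted here; the passage "(M)-data ⟹ SLE₃
law" survives, unconditionally and with the data as explicit hypotheses, as
`isSLELaw_three_of_drivingMartingales` (local) and
`isSLELaw_three_of_subseqLimit_spinInterface_of_forall_drivingMartingales` (global) in
`InterfaceSLEFrontier.lean`. After this file the named-fact frontier below the corrected spin
statement is `spinInterface_traversalBound` (C1, `InterfaceSLETightness.lean`; CDHKS §2 via
CDCH 2016 and KS 2017) and `isSLELaw_three_of_subseqLimit_spinInterface` (F2,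
`InterfaceSLEProofs.lean`; CDHKS Thm. 3 and §3 via KS 2017 and CS 2012).

## Mathlib

USED: `MeasureTheory.Martingale` (with `Martingale.smul`, its `StronglyAdapted` component), `Filtration`,
`StronglyMeasurable.measurable`, `BoundedContinuousFunction`, `Real.sqrt` algebra. From the tree:
`IsLocalMartingale`/`Martingale.isLocalMartingale` (`LocalMartingale.lean`),
`Process.HasQuadraticVariation` (`ItoCalculus.lean`), `IsSLECurve.map_eq_holds`
(`SLEUniquenessInLaw.lean`), and the spin-interface objects of `InterfaceSLEProofs.lean` /
`InterfaceSLETightness.lean`.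

## References

* D. Chelkak, H. Duminil-Copin, C. Hongler, A. Kemppainen, S. Smirnov, *Convergence of Ising
  interfaces to Schramm's SLE curves*, C. R. Math. Acad. Sci. Paris 352 (2014) 157–161
  (arXiv:1312.0533): Thm. 1, Thm. 2, Thm. 3 (p. 5), §3 (p. 7: "both coefficients `W_t` and
  `W_t² - 3t` are martingales. As `W_t` is almost surely continuous, Lévy's theorem implies
  that `W_t = √3 B_t`").
* A. Kemppainen, S. Smirnov, *Random curves, scaling limits and Loewner evolutions*, Ann. Probab.
  45 (2017) 698–779, Thm. 1.5 and Cor. 1.7 (arXiv:1212.6215v3: Thm. 1.3, Cor. 1.5).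
* D. Chelkak, S. Smirnov, *Universality in the 2D Ising model and conformal invariance of
  fermionic observables*, Invent. Math. 189 (2012) 515–580, Thms 1.2 and 5.6.
* P. Lévy (1948); D. Revuz, M. Yor, *Continuous Martingales and Brownian Motion* (1999), Ch. IV,
  Thm. (3.6).
-/

noncomputable section

open MeasureTheory Filter Topology
open UpperHalfPlane (upperHalfPlaneSet)
open scoped NNReal ENNReal BoundedContinuousFunction
open Literature.Probability.LatticeModels Literature.Probability.Percolation
open Literature.Probability.RandomPlanarGeometry (CurveClass DobrushinDomain ConformalEquiv)

namespace Literature.Probability.LatticeModels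

/-! ### The assemblies with uniqueness of the SLE law discharged -/

/-- **CDHKS Theorem 1 (corrected transcription) from its two halves**, uniqueness in law of
chordal SLE being now a theorem (`IsSLECurve.map_eq_holds`): tightness of the interface laws
(F1, `isTightMeasureSet_spinInterfaceLaw`, CDHKS §2) and identification of every subsequential
limit as the SLE₃ law (F2, `isSLELaw_three_of_subseqLimit_spinInterface`, CDHKS §3) imply
`convergesInLawToSLE_three_isingInterface_zd`. PROVED (`convergesInLawToSLE_three_isingInterface_zd_of_facts`).
[cite: CDHKSCRAS2014, Thm. 1 and §§2–3] -/
theorem convergesInLawToSLE_three_isingInterface_zd_of_facts'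
    (h₁ : isTightMeasureSet_spinInterfaceLaw) (h₂ : isSLELaw_three_of_subseqLimit_spinInterface) :
    convergesInLawToSLE_three_isingInterface_zd :=
  convergesInLawToSLE_three_isingInterface_zd_of_facts h₁ h₂
    RandomPlanarGeometry.IsSLECurve.map_eq_holds

/-- **CDHKS Theorem 1 (corrected transcription) from (C1) and F2**: with uniqueness of the SLE law
proved, `convergesInLawToSLE_three_isingInterface_zd` follows from the traversal bound
`spinInterface_traversalBound` (C1) and the identification fact F2 alone. PROVED
(`convergesInLawToSLE_three_isingInterface_zd_of_traversalBound`). [cite: CDHKSCRAS2014, Thm. 1 and §§2–3] -/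
theorem convergesInLawToSLE_three_isingInterface_zd_of_traversalBound'
    (h1 : spinInterface_traversalBound) (h2 : isSLELaw_three_of_subseqLimit_spinInterface) :
    convergesInLawToSLE_three_isingInterface_zd :=
  convergesInLawToSLE_three_isingInterface_zd_of_traversalBound h1 h2
    RandomPlanarGeometry.IsSLECurve.map_eq_holds

/-! ### The two CDHKS martingales in Lévy's format -/

/-- `3 ≠ 8` in `ℝ≥0` (the spin-Ising SLE parameter is in the Rohde–Schramm range). [folklore] -/
theorem three_ne_eight : (3 : ℝ≥0) ≠ 8 := by norm_num

/-- `(√3)⁻¹ ^ 2 = 3⁻¹` in `ℝ`. [folklore] -/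
theorem inv_sqrt_three_sq : (Real.sqrt 3)⁻¹ ^ 2 = (3 : ℝ)⁻¹ := by
  rw [inv_pow, Real.sq_sqrt (by norm_num : (0 : ℝ) ≤ 3)]

/-- **The two CDHKS martingales in Lévy's format.** If `W_t` and `W_t² - 3t` are martingales for a
filtration `𝓕` on the curve space, then `X = W/√3` is a continuous-time local martingale with
quadratic variation `⟨X⟩_t = t` in the sense of `Process.HasQuadraticVariation` (`X² - t =
(W² - 3t)/3` is a martingale, hence a local martingale). This is the sentence "Lévy's theorem
implies that `W_t = √3 B_t`" of CDHKS §3 up to the application of Lévy's theorem itself.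
[cite: CDHKSCRAS2014, §3] -/
theorem isLocalMartingale_and_hasQuadraticVariation_of_martingales
    {ν : Measure (CurveClass ℂ)} {W : CurveClass ℂ → ℝ≥0 → ℝ}
    {𝓕 : Filtration ℝ≥0 (inferInstance : MeasurableSpace (CurveClass ℂ))}
    (hM₁ : Martingale (fun t c => W c t) 𝓕 ν)
    (hM₂ : Martingale (fun t c => W c t ^ 2 - 3 * (t : ℝ)) 𝓕 ν) :
    RandomPlanarGeometry.IsLocalMartingale (fun t c => (Real.sqrt 3)⁻¹ * W c t) 𝓕 ν ∧
      Process.HasQuadraticVariation (fun t c => (Real.sqrt 3)⁻¹ * W c t) (fun t _ => (t : ℝ)) 𝓕 ν := by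
  have hX : Martingale (fun t c => (Real.sqrt 3)⁻¹ * W c t) 𝓕 ν := by
    have h := hM₁.smul (Real.sqrt 3)⁻¹
    exact h
  have hX2 : Martingale (fun t c => ((Real.sqrt 3)⁻¹ * W c t) ^ 2 - (t : ℝ)) 𝓕 ν := by
    have h := hM₂.smul (3 : ℝ)⁻¹
    have heq : ((3 : ℝ)⁻¹ • fun t c => W c t ^ 2 - 3 * (t : ℝ)) =
        fun t c => ((Real.sqrt 3)⁻¹ * W c t) ^ 2 - (t : ℝ) := by
      funext t c
      simp only [Pi.smul_apply, smul_eq_mul]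
      rw [mul_pow, inv_sqrt_three_sq]
      ring
    rw [heq] at h
    exact h
  refine ⟨hX.isLocalMartingale, ?_⟩
  exact
    { adapted := fun t => measurable_const
      continuous := ae_of_all _ fun _ => NNReal.continuous_coe
      monotone := ae_of_all _ fun _ _ _ h => NNReal.coe_le_coe.2 h
      zero := fun _ => NNReal.coe_zero
      isLocalMartingale := hX2.isLocalMartingale }

/-- A martingale for a filtration of sub-σ-algebras of the Borel σ-algebra of the curve space
has Borel measurable marginals. [folklore] -/
theorem measurable_of_martingale {ν : Measure (CurveClass ℂ)} {W : CurveClass ℂ → ℝ≥0 → ℝ}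
    {𝓕 : Filtration ℝ≥0 (inferInstance : MeasurableSpace (CurveClass ℂ))}
    (hM : Martingale (fun t c => W c t) 𝓕 ν) (t : ℝ≥0) : Measurable fun c => W c t :=
  ((hM.1 t).mono (𝓕.le t)).measurable

/-! ### The FK half (CDHKS Thm. 2) with uniqueness of the SLE law discharged -/

/-- **CDHKS Theorem 2 reduced to (C1-FK) and (L)**: `convergesInLawToSLE_sixteen_thirds_fkInterface`
from the FK traversal bound `fkInterface_traversalBound` and the identification fact
`isSLELaw_of_isSubseqLimitLaw_fkInterfaceCurve` alone (`FKIsingInterfaceTightness.lean`'s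
`convergesInLawToSLE_sixteen_thirds_fkInterface_of_traversalBound` with `huniq` discharged by
`IsSLECurve.map_eq_holds`). PROVED. [cite: CDHKSCRAS2014, Thm. 2] -/
theorem convergesInLawToSLE_sixteen_thirds_fkInterface_of_traversalBound'
    (h1 : fkInterface_traversalBound) (hL : isSLELaw_of_isSubseqLimitLaw_fkInterfaceCurve) :
    convergesInLawToSLE_sixteen_thirds_fkInterface :=
  convergesInLawToSLE_sixteen_thirds_fkInterface_of_traversalBound
    RandomPlanarGeometry.IsSLECurve.map_eq_holds h1 hL

end Literature.Probability.LatticeModels
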